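import Mathlib

/-!
# `DivisionGap.PerMultiplesHard` (stmt-ValiantsHypothesis-5068), line `uncharged-face-walk`:
# stub `stub_matchingGlue` — gluing partial matchings of a square sub-board into a perfect
# matching (lead c9, cycle 9)

Host `G ⊆ Fin n × Fin n` (cells `(row, column)`); a perfect matching is a permutation `σ` with
`(σ i, i) ∈ G` for every column `i` (`σ` maps COLUMNS to ROWS).  A block (rows `A`, columns `B`)
is `σ`-square when `σ i ∈ A ↔ i ∈ B`.

**Theorem (`stub_matchingGlue`).**
(i) (Plummer's `s`-extendability) Inside a `σ₀`-square sub-board `(R, C)` of a perfect matching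
`σ₀` with Hall surplus `s < #R` (`#N_C(U) ≥ #U + s` for nonempty `U ⊆ R` with `#U + s ≤ #R`),
every injective partial matching `g : A → B` (rows to columns, along `G`-cells) of a block
`A ⊆ R`, `B ⊆ C` with `#A = #B ≤ s` is contained (as `σ(B) = A`) in a perfect matching `σ` of
`G` which is again square on `(R, C)`.
(ii) (three-piece gluing) Injective matchings `f₁ : S → U`, `f₂ : C ∖ S → R ∖ U` along
`G`-cells and `σ₀` on `Cᶜ` glue to a perfect matching `σ` with `σ(S) = U`, `σ(C) = R`.

## Proof

(ii): the glued function `F j := f₁ j (j ∈ S), f₂ j (j ∈ C ∖ S), σ₀ j (j ∉ C)` satisfies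
`F j ∈ U ↔ j ∈ S` and `F j ∈ R ↔ j ∈ C` piecewise, hence is injective (equal values lie in the
same piece, and each piece is injective), hence bijective on the finite type `Fin n`
(`Finite.injective_iff_bijective`); take `σ := Equiv.ofBijective F`.
(i): `#R = #C` (`σ₀` maps `C` onto `R`).  Invert `g` on `B` (an injection between finsets of
equal size is onto, `Finset.surjOn_of_injOn_of_card_le`).  On the complement apply Hall's
marriage theorem (`Finset.all_card_le_biUnion_card_iff_exists_injective`) to the rows `R ∖ A`
with neighbourhoods in `C ∖ B`: for `U ⊆ R ∖ A`, if `#U + s ≤ #R` the surplus gives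
`#(N(U) ∖ B) ≥ #U + s - #B ≥ #U`; otherwise a sub-family `U' ⊆ U` with `#U' = #R - s ≥ 1`
already has `#N(U') ≥ #R = #C`, so `N(U) = C` and `#(C ∖ B) = #C - #B = #(R ∖ A) ≥ #U`.
Invert the resulting injection `R ∖ A → C ∖ B` (again onto, by cardinality) and glue with (ii).
[folklore]

Leans on Mathlib only.  No definitions.
-/

noncomputable section

-- `Summit.ValiantsHypothesis.ValiantsHypothesis.…` is the tree's mandated layout (Sub = Summit).
set_option linter.dupNamespace false

open Finset
open scoped BigOperators

namespace Summit.ValiantsHypothesis.ValiantsHypothesis.Theorems.DivisionGap.PerMultiplesHard.MatchingGlue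

/-- A permutation `σ₀` that is square on `(R, C)` (`σ₀ i ∈ R ↔ i ∈ C`) maps `C` onto `R`, so
`#R = #C`. [folklore] -/
theorem card_eq_of_square {n : ℕ} (R C : Finset (Fin n)) (σ₀ : Equiv.Perm (Fin n))
    (hσ : ∀ i, σ₀ i ∈ R ↔ i ∈ C) : R.card = C.card := by
  have hRC : R = C.map σ₀.toEmbedding := by
    ext r
    rw [Finset.mem_map_equiv, ← hσ, Equiv.apply_symm_apply]
  rw [hRC, Finset.card_map]

/-- THREE-PIECE GLUING (part (ii) of `stub_matchingGlue`): injective matchings `f₁ : S → U`,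
`f₂ : C ∖ S → R ∖ U` along `G`-cells together with `σ₀` restricted to `Cᶜ` (which `σ₀` maps into
`Rᶜ`) glue to a perfect matching `σ` of `G` with `σ i ∈ U ↔ i ∈ S` and `σ i ∈ R ↔ i ∈ C`: the
glued function is injective on the finite type `Fin n`, hence bijective.  No cardinality
hypothesis is needed. [folklore] -/
theorem glue_three {n : ℕ} (G : Finset (Fin n × Fin n)) (R C U S : Finset (Fin n))
    (σ₀ : Equiv.Perm (Fin n)) (f₁ f₂ : Fin n → Fin n)
    (hG : ∀ i, (σ₀ i, i) ∈ G) (hσ : ∀ i, σ₀ i ∈ R ↔ i ∈ C) (hUR : U ⊆ R) (hSC : S ⊆ C)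
    (h₁ : ∀ j ∈ S, f₁ j ∈ U ∧ (f₁ j, j) ∈ G) (h₁i : ∀ j ∈ S, ∀ j' ∈ S, f₁ j = f₁ j' → j = j')
    (h₂ : ∀ j ∈ C \ S, f₂ j ∈ R \ U ∧ (f₂ j, j) ∈ G)
    (h₂i : ∀ j ∈ C \ S, ∀ j' ∈ C \ S, f₂ j = f₂ j' → j = j') :
    ∃ σ : Equiv.Perm (Fin n),
      (∀ i, (σ i, i) ∈ G) ∧ (∀ i, σ i ∈ U ↔ i ∈ S) ∧ (∀ i, σ i ∈ R ↔ i ∈ C) := by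
  let F : Fin n → Fin n := fun j => if j ∈ S then f₁ j else if j ∈ C then f₂ j else σ₀ j
  have hFU : ∀ j, F j ∈ U ↔ j ∈ S := by
    intro j
    by_cases hjS : j ∈ S
    · simp only [F, if_pos hjS, hjS, iff_true]
      exact (h₁ j hjS).1
    · by_cases hjC : j ∈ C
      · simp only [F, if_neg hjS, if_pos hjC, hjS, iff_false]
        exact (Finset.mem_sdiff.mp (h₂ j (Finset.mem_sdiff.mpr ⟨hjC, hjS⟩)).1).2
      · simp only [F, if_neg hjS, if_neg hjC, hjS, iff_false]
        exact fun h => hjC ((hσ j).mp (hUR h))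
  have hFR : ∀ j, F j ∈ R ↔ j ∈ C := by
    intro j
    by_cases hjS : j ∈ S
    · simp only [F, if_pos hjS, hSC hjS, iff_true]
      exact hUR (h₁ j hjS).1
    · by_cases hjC : j ∈ C
      · simp only [F, if_neg hjS, if_pos hjC]
        exact iff_of_true (Finset.mem_sdiff.mp (h₂ j (Finset.mem_sdiff.mpr ⟨hjC, hjS⟩)).1).1 hjC
      · simp only [F, if_neg hjS, if_neg hjC]
        exact hσ j
  have hFG : ∀ j, (F j, j) ∈ G := by
    intro j
    by_cases hjS : j ∈ S
    · simp only [F, if_pos hjS]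
      exact (h₁ j hjS).2
    · by_cases hjC : j ∈ C
      · simp only [F, if_neg hjS, if_pos hjC]
        exact (h₂ j (Finset.mem_sdiff.mpr ⟨hjC, hjS⟩)).2
      · simp only [F, if_neg hjS, if_neg hjC]
        exact hG j
  have hFinj : Function.Injective F := by
    intro j j' hjj'
    have hS : j ∈ S ↔ j' ∈ S := by rw [← hFU j, ← hFU j', hjj']
    have hC : j ∈ C ↔ j' ∈ C := by rw [← hFR j, ← hFR j', hjj']
    by_cases hjS : j ∈ S
    · have hj'S : j' ∈ S := hS.mp hjS
      simp only [F, if_pos hjS, if_pos hj'S] at hjj'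
      exact h₁i j hjS j' hj'S hjj'
    · have hj'S : j' ∉ S := fun h => hjS (hS.mpr h)
      by_cases hjC : j ∈ C
      · have hj'C : j' ∈ C := hC.mp hjC
        simp only [F, if_neg hjS, if_neg hj'S, if_pos hjC, if_pos hj'C] at hjj'
        exact h₂i j (Finset.mem_sdiff.mpr ⟨hjC, hjS⟩) j' (Finset.mem_sdiff.mpr ⟨hj'C, hj'S⟩) hjj'
      · have hj'C : j' ∉ C := fun h => hjC (hC.mpr h)
        simp only [F, if_neg hjS, if_neg hj'S, if_neg hjC, if_neg hj'C] at hjj'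
        exact σ₀.injective hjj'
  exact ⟨Equiv.ofBijective F (Finite.injective_iff_bijective.mp hFinj), hFG, hFU, hFR⟩

/-- INVERTING A PARTIAL MATCHING: an injective partial matching `φ : X → Y` along `G`-cells
(rows `x` to columns `φ x`, `(x, φ x) ∈ G`) with `#Y ≤ #X` is onto `Y`
(`Finset.surjOn_of_injOn_of_card_le`), so it has an inverse `ψ`, injective on `Y`, along the
same cells (`(ψ j, j) ∈ G`). [folklore] -/
theorem exists_inverse_matching {n : ℕ} (G : Finset (Fin n × Fin n)) (X Y : Finset (Fin n))
    (φ : Fin n → Fin n) (hmap : ∀ x ∈ X, φ x ∈ Y ∧ (x, φ x) ∈ G)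
    (hinj : ∀ x ∈ X, ∀ x' ∈ X, φ x = φ x' → x = x') (hcard : Y.card ≤ X.card) :
    ∃ ψ : Fin n → Fin n,
      (∀ j ∈ Y, ψ j ∈ X ∧ (ψ j, j) ∈ G) ∧ (∀ j ∈ Y, ∀ j' ∈ Y, ψ j = ψ j' → j = j') := by
  have hsurj : Set.SurjOn φ ↑X ↑Y :=
    Finset.surjOn_of_injOn_of_card_le φ (fun x hx => (hmap x hx).1)
      (fun x hx x' hx' h => hinj x hx x' hx' h) hcard
  have hex : ∀ j, ∃ x, j ∈ Y → x ∈ X ∧ φ x = j := by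
    intro j
    by_cases hj : j ∈ Y
    · obtain ⟨x, hx, hxj⟩ := hsurj (Finset.mem_coe.mpr hj)
      exact ⟨x, fun _ => ⟨hx, hxj⟩⟩
    · exact ⟨j, fun h => absurd h hj⟩
  choose ψ hψ using hex
  refine ⟨ψ, fun j hj => ⟨(hψ j hj).1, ?_⟩, fun j hj j' hj' h => ?_⟩
  · have hGx := (hmap _ (hψ j hj).1).2
    rwa [(hψ j hj).2] at hGx
  · calc j = φ (ψ j) := (hψ j hj).2.symm
      _ = φ (ψ j') := by rw [h]
      _ = j' := (hψ j' hj').2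

/-- SURPLUS ⇒ HALL ON THE COMPLEMENT OF A SMALL BLOCK: if the sub-board `(R, C)` (`#R = #C`) has
Hall surplus `s < #R` and `A ⊆ R`, `B ⊆ C`, `#A = #B ≤ s`, then every `U ⊆ R ∖ A` has at least
`#U` `G`-neighbours in `C ∖ B`.  If `#U + s ≤ #R` this is the surplus minus `#B ≤ s`; otherwise a
sub-family `U' ⊆ U` with `#U' = #R - s ≥ 1` already sees all of `C`, and
`#(C ∖ B) = #(R ∖ A) ≥ #U`. [folklore] -/
theorem hall_complement {n s : ℕ} (G : Finset (Fin n × Fin n)) (R C A B : Finset (Fin n))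
    (hs : s < R.card) (hRC : R.card = C.card)
    (hsur : ∀ U ⊆ R, U.Nonempty → U.card + s ≤ R.card →
      U.card + s ≤ (C.filter fun j => ∃ r ∈ U, (r, j) ∈ G).card)
    (hAR : A ⊆ R) (hBC : B ⊆ C) (hAB : A.card = B.card) (hAs : A.card ≤ s)
    (U : Finset (Fin n)) (hU : U ⊆ R \ A) :
    U.card ≤ ((C.filter fun j => ∃ r ∈ U, (r, j) ∈ G) \ B).card := by
  rcases U.eq_empty_or_nonempty with rfl | hne
  · simp
  have hUR : U ⊆ R := hU.trans Finset.sdiff_subset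
  by_cases hc : U.card + s ≤ R.card
  · have h1 := hsur U hUR hne hc
    have h2 := Finset.le_card_sdiff B (C.filter fun j => ∃ r ∈ U, (r, j) ∈ G)
    omega
  · push Not at hc
    obtain ⟨U', hU'U, hU'card⟩ :=
      Finset.exists_subset_card_eq (show R.card - s ≤ U.card by omega)
    have hU'ne : U'.Nonempty := by
      rw [← Finset.card_pos]
      omega
    have h1 := hsur U' (hU'U.trans hUR) hU'ne (by omega)
    have hN'N : (C.filter fun j => ∃ r ∈ U', (r, j) ∈ G) ⊆
        (C.filter fun j => ∃ r ∈ U, (r, j) ∈ G) := by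
      intro j hj
      simp only [Finset.mem_filter] at hj ⊢
      exact ⟨hj.1, hj.2.imp fun r hr => ⟨hU'U hr.1, hr.2⟩⟩
    have hN'card := Finset.card_le_card hN'N
    have hNC : (C.filter fun j => ∃ r ∈ U, (r, j) ∈ G) = C :=
      Finset.eq_of_subset_of_card_le (Finset.filter_subset _ _) (by omega)
    rw [hNC, Finset.card_sdiff_of_subset hBC]
    have h3 := Finset.card_le_card hU
    rw [Finset.card_sdiff_of_subset hAR] at h3
    omega

/-- PLUMMER EXTENSION (part (i) of `stub_matchingGlue`): in a `σ₀`-square sub-board `(R, C)` with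
Hall surplus `s`, an injective partial matching `g : A → B` of a block with `#A = #B ≤ s` lies in
a perfect matching `σ` of `G` with `σ i ∈ A ↔ i ∈ B` and `σ i ∈ R ↔ i ∈ C`: invert `g` on `B`,
find a perfect matching of `G[R ∖ A, C ∖ B]` by Hall (`hall_complement`), invert it, and glue
the three pieces with `glue_three`. [folklore] -/
theorem extend_block {n s : ℕ} (G : Finset (Fin n × Fin n)) (R C A B : Finset (Fin n))
    (σ₀ : Equiv.Perm (Fin n)) (g : Fin n → Fin n)
    (hG : ∀ i, (σ₀ i, i) ∈ G) (hσ : ∀ i, σ₀ i ∈ R ↔ i ∈ C) (hs : s < R.card)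
    (hsur : ∀ U ⊆ R, U.Nonempty → U.card + s ≤ R.card →
      U.card + s ≤ (C.filter fun j => ∃ r ∈ U, (r, j) ∈ G).card)
    (hAR : A ⊆ R) (hBC : B ⊆ C) (hAB : A.card = B.card) (hAs : A.card ≤ s)
    (hg : ∀ x ∈ A, g x ∈ B ∧ (x, g x) ∈ G) (hginj : ∀ x ∈ A, ∀ x' ∈ A, g x = g x' → x = x') :
    ∃ σ : Equiv.Perm (Fin n),
      (∀ i, (σ i, i) ∈ G) ∧ (∀ i, σ i ∈ A ↔ i ∈ B) ∧ (∀ i, σ i ∈ R ↔ i ∈ C) := by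
  have hRC : R.card = C.card := card_eq_of_square R C σ₀ hσ
  -- piece 1: invert `g` on `B`
  obtain ⟨f₁, hf₁, hf₁i⟩ := exists_inverse_matching G A B g hg hginj hAB.ge
  -- piece 2: Hall's condition for the rows `R \ A` with neighbourhoods in `C \ B`
  have hHall : ∀ sU : Finset {x // x ∈ R \ A},
      sU.card ≤ (sU.biUnion fun u => (C \ B).filter fun j => ((u : Fin n), j) ∈ G).card := by
    intro sU
    have hUsub : sU.map (Function.Embedding.subtype _) ⊆ R \ A :=
      fun r hr => Finset.property_of_mem_map_subtype sU hr
    have hsub : (C.filter fun j => ∃ r ∈ sU.map (Function.Embedding.subtype _), (r, j) ∈ G) \ B ⊆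
        sU.biUnion fun u => (C \ B).filter fun j => ((u : Fin n), j) ∈ G := by
      intro j hj
      rw [Finset.mem_sdiff, Finset.mem_filter] at hj
      obtain ⟨⟨hjC, r, hrU, hrj⟩, hjB⟩ := hj
      obtain ⟨u, huS, rfl⟩ := Finset.mem_map.mp hrU
      exact Finset.mem_biUnion.mpr
        ⟨u, huS, Finset.mem_filter.mpr ⟨Finset.mem_sdiff.mpr ⟨hjC, hjB⟩, hrj⟩⟩
    calc sU.card = (sU.map (Function.Embedding.subtype _)).card := (Finset.card_map _).symm
      _ ≤ _ := hall_complement G R C A B hs hRC hsur hAR hBC hAB hAs _ hUsub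
      _ ≤ _ := Finset.card_le_card hsub
  obtain ⟨h, hinj, hh⟩ := (Finset.all_card_le_biUnion_card_iff_exists_injective _).mp hHall
  -- extend the Hall injection `h : R \ A → C \ B` to all rows and invert it
  let h' : Fin n → Fin n := fun r => if hr : r ∈ R \ A then h ⟨r, hr⟩ else r
  have hmap : ∀ x ∈ R \ A, h' x ∈ C \ B ∧ (x, h' x) ∈ G := by
    intro x hx
    have hx' := hh ⟨x, hx⟩
    simp only [Finset.mem_filter] at hx'
    simp only [h', dif_pos hx]
    exact hx'
  have hinj' : ∀ x ∈ R \ A, ∀ x' ∈ R \ A, h' x = h' x' → x = x' := by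
    intro x hx x' hx' hxx'
    simp only [h', dif_pos hx, dif_pos hx'] at hxx'
    exact congrArg Subtype.val (hinj hxx')
  have hcard : (C \ B).card ≤ (R \ A).card := by
    rw [Finset.card_sdiff_of_subset hBC, Finset.card_sdiff_of_subset hAR, hRC, hAB]
  obtain ⟨f₂, hf₂, hf₂i⟩ := exists_inverse_matching G (R \ A) (C \ B) h' hmap hinj' hcard
  exact glue_three G R C A B σ₀ f₁ f₂ hG hσ hAR hBC hf₁ hf₁i hf₂ hf₂i

/-- **Matching glue** (`stub_matchingGlue`).  (i) PLUMMER EXTENSION: inside a `σ₀`-square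
sub-board `(R, C)` of a perfect matching `σ₀` of the host `G`, with Hall surplus `s < #R`, every
injective partial matching `g : A → B` of a block `A ⊆ R`, `B ⊆ C`, `#A = #B ≤ s` extends to a
perfect matching `σ` of `G` with `σ i ∈ A ↔ i ∈ B` and `σ i ∈ R ↔ i ∈ C` (invert `g`, Hall on
the complement `G[R ∖ A, C ∖ B]`, glue with `σ₀` outside `C`).  (ii) THREE-PIECE GLUING:
injective matchings `S → U`, `C ∖ S → R ∖ U` and `σ₀` on `Cᶜ` glue to a perfect matching square
on `(U, S)` and on `(R, C)`.  Route: `extend_block` and `glue_three`. [folklore] -/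
theorem stub_matchingGlue :
    (∀ (n s : ℕ) (G : Finset (Fin n × Fin n)) (R C A B : Finset (Fin n)) (σ₀ : Equiv.Perm (Fin n)) (g : Fin n → Fin n),
      (∀ i, (σ₀ i, i) ∈ G) → (∀ i, σ₀ i ∈ R ↔ i ∈ C) → s < R.card →
      (∀ U ⊆ R, U.Nonempty → U.card + s ≤ R.card →
        U.card + s ≤ (C.filter fun j => ∃ r ∈ U, (r, j) ∈ G).card) →
      A ⊆ R → B ⊆ C → A.card = B.card → A.card ≤ s →
      (∀ x ∈ A, g x ∈ B ∧ (x, g x) ∈ G) → (∀ x ∈ A, ∀ x' ∈ A, g x = g x' → x = x') →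
      ∃ σ : Equiv.Perm (Fin n), (∀ i, (σ i, i) ∈ G) ∧ (∀ i, σ i ∈ A ↔ i ∈ B) ∧ (∀ i, σ i ∈ R ↔ i ∈ C)) ∧
    (∀ (n : ℕ) (G : Finset (Fin n × Fin n)) (R C U S : Finset (Fin n)) (σ₀ : Equiv.Perm (Fin n)) (f₁ f₂ : Fin n → Fin n),
      (∀ i, (σ₀ i, i) ∈ G) → (∀ i, σ₀ i ∈ R ↔ i ∈ C) → U ⊆ R → S ⊆ C → U.card = S.card →
      (∀ j ∈ S, f₁ j ∈ U ∧ (f₁ j, j) ∈ G) → (∀ j ∈ S, ∀ j' ∈ S, f₁ j = f₁ j' → j = j') →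
      (∀ j ∈ C \ S, f₂ j ∈ R \ U ∧ (f₂ j, j) ∈ G) → (∀ j ∈ C \ S, ∀ j' ∈ C \ S, f₂ j = f₂ j' → j = j') →
      ∃ σ : Equiv.Perm (Fin n), (∀ i, (σ i, i) ∈ G) ∧ (∀ i, σ i ∈ U ↔ i ∈ S) ∧ (∀ i, σ i ∈ R ↔ i ∈ C)) := by
  refine ⟨?_, ?_⟩
  · intro n s G R C A B σ₀ g hG hσ hs hsur hAR hBC hAB hAs hg hginj
    exact extend_block G R C A B σ₀ g hG hσ hs hsur hAR hBC hAB hAs hg hginj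
  · intro n G R C U S σ₀ f₁ f₂ hG hσ hUR hSC _ h₁ h₁i h₂ h₂i
    exact glue_three G R C U S σ₀ f₁ f₂ hG hσ hUR hSC h₁ h₁i h₂ h₂i

end Summit.ValiantsHypothesis.ValiantsHypothesis.Theorems.DivisionGap.PerMultiplesHard.MatchingGlue

end
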